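import Mathlib
import Summits.Ventures.PercRepro2.Defs
import Summits.Ventures.PercRepro2.Graph
import Summits.Ventures.PercRepro2.Induced
import Summits.Ventures.PercRepro2.VdBKahn
import Summits.Ventures.PercRepro2.ReimerVdBK
import Summits.Ventures.PercRepro2.ReimerVdBKRegions
import Summits.Ventures.PercRepro2.ReimerVdBKFlip
import Summits.Ventures.PercRepro2.ReimerVdBKTrivialCore

/-!
# (R-1.2) on the blue-self-sufficient-core stratum
(blind cell PercRepro2, mine-c g44; `conjectures/MINE-C.md` §53.6)

THEOREM (`count_twoWorld_blueSelfSufficient_le`): for every `(A, X, B, Y)`,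
  `#{ω ∈ L : every core vertex is world-2-reachable from s inside G[K₁ ∩ K₂]} ≤ #{ω ∈ R : same}`.
This strictly contains the trivial-core stratum (`count_twoWorld_trivialCore_le`): the core may be
arbitrary as long as world 2 serves it WITHOUT excursions into its private region — exactly the
condition under which the component flip `Ψ` (recolour the components of `K₂ \ K₁` meeting `B ∪ X`)
removes EXACTLY the flipped components from world 2 (`K₂_flipAt_of_blueSS`), keeps the core and its
internal world-2 connectivity, and is recovered from its image.  The world-1 analogue (red
self-sufficiency) is FALSE (census: 1,237 / 14,462 instances at n = 4) — the asymmetry of the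
injection, which dismantles world 2 only.
-/

namespace Summit.Ventures.PercRepro2

namespace ReimerVdBK

open Classical

variable {V : Type*} {E : Type*} [Fintype E] [DecidableEq E] [Fintype V] [DecidableEq V]

variable (ends : E → Sym2 V) (s : V)

/-- The stratum: every core vertex is world-2-reachable from the root inside the core. -/
def BlueSelfSufficient (ω : Config E) : Prop :=
  ∀ v ∈ core ends s ω, Conn ends (induced ends (core ends s ω) (compl ω)) s v

section Stratum

variable {ω : Config E} {D : Set V}

omit [Fintype E] [DecidableEq E] [Fintype V] [DecidableEq V] in
/-- An edge inside the core does not touch a subset of the world-2-private region. -/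
lemma not_touches_of_within_core (hD : D ⊆ only2 ends s ω) {e : E}
    (he : e ∈ within ends (core ends s ω)) : e ∉ touches ends D := by
  rintro ⟨x, hxD, y, hxy⟩
  obtain ⟨x', hx', y', hy', hxy'⟩ := he
  rw [hxy, Sym2.eq_iff] at hxy'
  have hxC : x ∈ core ends s ω := by
    rcases hxy' with ⟨h1, _⟩ | ⟨h1, _⟩
    · rw [h1]; exact hx'
    · rw [h1]; exact hy'
  exact ((mem_only2 ends s).1 (hD hxD)).2 hxC.1

omit [Fintype E] [DecidableEq E] [Fintype V] [DecidableEq V] in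
/-- The world-2 edges inside the core are untouched by the flip. -/
lemma induced_core_compl_flipAt (hD : D ⊆ only2 ends s ω) :
    induced ends (core ends s ω) (compl (flipAt ends D ω)) =
      induced ends (core ends s ω) (compl ω) := by
  apply induced_congr
  intro e he
  simp only [compl, flipAt_of_not_mem ends (ω := ω) (not_touches_of_within_core ends s hD he)]

omit [Fintype E] [DecidableEq E] [Fintype V] [DecidableEq V] in
/-- On the stratum every core vertex stays in world 2 after the flip. -/
lemma mem_K₂_flipAt_of_mem_core (hss : BlueSelfSufficient ends s ω) (hD : D ⊆ only2 ends s ω)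
    {v : V} (hv : v ∈ core ends s ω) : v ∈ K₂ ends s (flipAt ends D ω) := by
  have h := hss v hv
  rw [← induced_core_compl_flipAt ends s hD] at h
  exact conn_mono (induced_le _ _) h

omit [Fintype E] [DecidableEq E] [Fintype V] [DecidableEq V] in
/-- **World 2 loses exactly the flipped part on the stratum**: `K₂ (flipAt D ω) = K₂ ω \ D`. -/
theorem K₂_flipAt_of_blueSS (hss : BlueSelfSufficient ends s ω) (hD : D ⊆ only2 ends s ω)
    (hcl : ∀ e x y, ends e = s(x, y) → x ∈ D → y ∉ D → y ∉ only2 ends s ω) :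
    K₂ ends s (flipAt ends D ω) = K₂ ends s ω \ D := by
  refine Set.Subset.antisymm (K₂_flipAt_subset ends s hD hcl) ?_
  have hclosed : ∀ x ∈ K₂ ends s (flipAt ends D ω) ∪ D, ∀ y,
      (openGraph ends (compl ω)).Adj x y → y ∈ K₂ ends s (flipAt ends D ω) ∪ D := by
    intro x hx y hxy
    obtain ⟨-, e, he, hends⟩ := openGraph_adj.1 hxy
    have he0 : ω e = false := by simpa [compl] using he
    by_cases hyD : y ∈ D
    · exact Or.inr hyD
    rcases hx with hx | hx
    · by_cases ht : e ∈ touches ends D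
      · have hxD : x ∉ D := fun h => ((K₂_flipAt_subset ends s hD hcl) hx).2 h
        exact absurd (mem_of_touches_of_not_mem ends ht hends hxD) hyD
      · have he0' : flipAt ends D ω e = false := by rw [flipAt_of_not_mem ends (ω := ω) ht]; exact he0
        have he' : compl (flipAt ends D ω) e = true := by simp [compl, he0']
        exact Or.inl (mem_K₁_of_open ends s (ω := compl (flipAt ends D ω)) hx he' hends)
    · -- `x ∈ D`, `y ∉ D`, blue edge: `y ∈ K₂`, by closedness `y ∈ K₁`, so `y` is a core vertex
      have hy2 : y ∈ K₂ ends s ω := mem_K₂_of_closed ends s (mem_K₂_of_mem_D ends s hD hx) he0 hends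
      have hy1 : y ∈ K₁ ends s ω := by
        have hno := hcl e x y hends hx hyD
        by_contra hy1
        exact hno ((mem_only2 ends s).2 ⟨hy2, hy1⟩)
      exact Or.inl (mem_K₂_flipAt_of_mem_core ends s hss hD ⟨hy1, hy2⟩)
  intro v hv
  have hvT : v ∈ K₂ ends s (flipAt ends D ω) ∪ D :=
    mem_of_conn_of_closed hclosed (Or.inl (root_mem_K₂ ends s _)) hv.1
  rcases hvT with h | h
  · exact h
  · exact absurd h hv.2

omit [Fintype E] [DecidableEq E] [Fintype V] [DecidableEq V] in
/-- The core is unchanged by the flip on the stratum. -/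
theorem core_flipAt_of_blueSS (hss : BlueSelfSufficient ends s ω) (hD : D ⊆ only2 ends s ω)
    (hcl : ∀ e x y, ends e = s(x, y) → x ∈ D → y ∉ D → y ∉ only2 ends s ω) :
    core ends s (flipAt ends D ω) = core ends s ω := by
  unfold core
  rw [K₁_flipAt ends s hD hcl, K₂_flipAt_of_blueSS ends s hss hD hcl]
  ext v
  simp only [Set.mem_inter_iff, Set.mem_union, Set.mem_sdiff]
  constructor
  · rintro ⟨h1 | h1, h2, h3⟩
    · exact ⟨h1, h2⟩
    · exact absurd h1 h3
  · rintro ⟨h1, h2⟩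
    exact ⟨Or.inl h1, h2, fun h => not_mem_K₁_of_mem_D ends s hD h h1⟩

omit [Fintype E] [DecidableEq E] [Fintype V] [DecidableEq V] in
/-- The stratum is preserved by the flip. -/
theorem blueSS_flipAt (hss : BlueSelfSufficient ends s ω) (hD : D ⊆ only2 ends s ω)
    (hcl : ∀ e x y, ends e = s(x, y) → x ∈ D → y ∉ D → y ∉ only2 ends s ω) :
    BlueSelfSufficient ends s (flipAt ends D ω) := by
  intro v hv
  rw [core_flipAt_of_blueSS ends s hss hD hcl] at hv ⊢
  rw [induced_core_compl_flipAt ends s hD]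
  exact hss v hv

omit [Fintype E] [DecidableEq E] [Fintype V] [DecidableEq V] in
/-- The world-1-private region of the flip is the old one together with the flipped part. -/
theorem only1_flipAt_of_blueSS (hss : BlueSelfSufficient ends s ω) (hD : D ⊆ only2 ends s ω)
    (hcl : ∀ e x y, ends e = s(x, y) → x ∈ D → y ∉ D → y ∉ only2 ends s ω) :
    only1 ends s (flipAt ends D ω) = only1 ends s ω ∪ D := by
  unfold only1
  rw [K₁_flipAt ends s hD hcl, K₂_flipAt_of_blueSS ends s hss hD hcl]
  ext v
  simp only [Set.mem_sdiff, Set.mem_union, not_and, not_not]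
  constructor
  · rintro ⟨h1 | h1, h2⟩
    · by_cases hvD : v ∈ D
      · exact Or.inr hvD
      · exact Or.inl ⟨h1, fun h => hvD (h2 h)⟩
    · exact Or.inr h1
  · rintro (⟨h1, h2⟩ | h)
    · exact ⟨Or.inl h1, fun h => absurd h h2⟩
    · exact ⟨Or.inr h, fun _ => h⟩

end Stratum

section Injection

variable (B X : Finset V)

omit [Fintype E] [DecidableEq E] [Fintype V] in
/-- `Ψ` preserves the stratum. -/
theorem blueSS_Ψ {ω : Config E} (hss : BlueSelfSufficient ends s ω) :
    BlueSelfSufficient ends s (Ψ ends s B X ω) :=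
  blueSS_flipAt ends s hss (flipSet_subset ends s B X ω) (flipSet_closed ends s B X ω)

omit [Fintype E] [DecidableEq E] [Fintype V] in
/-- **The flip set is recovered from the image** on the stratum, for `ω ∈ L`. -/
theorem hitSet_only1_Ψ_of_blueSS {A Y : Finset V} {ω : Config E}
    (hss : BlueSelfSufficient ends s ω) (hω : ω ∈ twoWorld ends s A X B Y) :
    hitSet ends (only1 ends s (Ψ ends s B X ω)) (B ∪ X) = flipSet ends s B X ω := by
  set D := flipSet ends s B X ω with hDdef
  have hD := flipSet_subset ends s B X ω
  have hcl := flipSet_closed ends s B X ω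
  have h1 : only1 ends s (Ψ ends s B X ω) = only1 ends s ω ∪ D :=
    only1_flipAt_of_blueSS ends s hss hD hcl
  rw [mem_twoWorld_iff] at hω
  obtain ⟨hA, hX, hB, hY⟩ := hω
  have hBX : ∀ w ∈ B ∪ X, w ∉ only1 ends s ω := by
    intro w hw hw1
    rcases Finset.mem_union.1 hw with hw | hw
    · exact ((mem_only1 ends s).1 hw1).2 (hB w hw)
    · exact hX w hw ((mem_only1 ends s).1 hw1).1
  have hclD : ∀ e x y, ends e = s(x, y) → x ∈ D → y ∈ only1 ends s ω ∪ D → y ∈ D := by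
    intro e x y hends hx hy
    rcases hy with hy | hy
    · exfalso
      exact not_adj_only1_only2 ends s hy (hD hx) e (by rw [hends, Sym2.eq_swap])
    · exact hy
  rw [h1]
  ext v
  constructor
  · rintro ⟨hv, w, hw, hwS, hvw⟩
    have hwD : w ∈ D := by
      rcases hwS with hwS | hwS
      · exact absurd hwS (hBX w hw)
      · exact hwS
    have hwv : GConn ends (only1 ends s ω ∪ D) w v := gconn_symm ends hvw
    exact mem_of_gconn ends hwD (gconn_of_closed ends hclD hwD hwv)
  · intro hv
    have hvD : v ∈ D := hv
    obtain ⟨hv2, w, hw, hw2, hvw⟩ := hv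
    have hwD : w ∈ D := mem_hitSet_of_mem ends hw hw2
    have hclD' : ∀ e x y, ends e = s(x, y) → x ∈ D → y ∈ only2 ends s ω → y ∈ D :=
      fun _ _ _ hends hx hy => hitSet_closed ends hends hx hy
    have hvwD : GConn ends D v w := gconn_of_closed ends hclD' hvD hvw
    exact ⟨Or.inr hvD, w, hw, Or.inr hwD, gconn_mono ends Set.subset_union_right hvwD⟩

omit [Fintype E] [DecidableEq E] [Fintype V] in
/-- **`Ψ` is injective on `L ∩ stratum`.** -/
theorem Ψ_injOn_of_blueSS {A Y : Finset V} {ω ω' : Config E} (hss : BlueSelfSufficient ends s ω)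
    (hω : ω ∈ twoWorld ends s A X B Y) (hss' : BlueSelfSufficient ends s ω')
    (hω' : ω' ∈ twoWorld ends s A X B Y) (h : Ψ ends s B X ω = Ψ ends s B X ω') : ω = ω' := by
  have hD : flipSet ends s B X ω = flipSet ends s B X ω' := by
    rw [← hitSet_only1_Ψ_of_blueSS ends s B X hss hω, ← hitSet_only1_Ψ_of_blueSS ends s B X hss' hω', h]
  calc ω = flipAt ends (flipSet ends s B X ω) (Ψ ends s B X ω) := (flipAt_flipAt ends _ ω).symm
    _ = flipAt ends (flipSet ends s B X ω') (Ψ ends s B X ω') := by rw [hD, h]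
    _ = ω' := flipAt_flipAt ends _ ω'

end Injection

omit [Fintype V] in
/-- **(R-1.2) on the blue-self-sufficient-core stratum**: for every `(A, X, B, Y)`,
`#{ω ∈ twoWorld A X B Y : BlueSelfSufficient ω} ≤ #{ω ∈ twoWorld (A ∪ B) (X ∩ Y) ∅ (X ∪ Y) : BlueSelfSufficient ω}`. -/
theorem count_twoWorld_blueSelfSufficient_le (A X B Y : Finset V) :
    count (twoWorld ends s A X B Y ∩ {ω | BlueSelfSufficient ends s ω}) ≤
      count (twoWorld ends s (A ∪ B) (X ∩ Y) ∅ (X ∪ Y) ∩ {ω | BlueSelfSufficient ends s ω}) := by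
  rw [count_eq_card, count_eq_card]
  refine Finset.card_le_card_of_injOn (Ψ ends s B X) ?_ ?_
  · intro ω hω
    simp only [Finset.coe_filter, Finset.mem_univ, true_and, Set.mem_setOf_eq, Set.mem_inter_iff] at hω ⊢
    exact ⟨Ψ_mem_twoWorld ends s B X hω.1, blueSS_Ψ ends s B X hω.2⟩
  · intro ω hω ω' hω' h
    simp only [Finset.coe_filter, Finset.mem_univ, true_and, Set.mem_setOf_eq, Set.mem_inter_iff] at hω hω'
    exact Ψ_injOn_of_blueSS ends s B X hω.2 hω.1 hω'.2 hω'.1 h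

omit [Fintype E] [DecidableEq E] [Fintype V] [DecidableEq V] in
/-- The trivial-core stratum lies in the blue-self-sufficient one. -/
lemma blueSS_of_trivialCore {ω : Config E} (h : trivialCore ends s ω) :
    BlueSelfSufficient ends s ω := by
  intro v hv
  have hvs : v = s := eq_root_of_trivialCore ends s h hv.1 hv.2
  rw [hvs]
  exact conn_refl _ _ s

end ReimerVdBK

end Summit.Ventures.PercRepro2
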